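import Summits.BirchSwinnertonDyer.Rank1Residual.X11b.RouteP2OpenInputFromPrint
import Summits.BirchSwinnertonDyer.Rank1Residual.X11b.BDPRouteTwistCertificateRecord
import HarnessLib

/-!
# Class X11b, route p2 at `p ≥ 5`: THE OPEN INPUT SPLIT INTO HALVES ON EVERY PAIR — (H1∧H2) the
# BDP frame-and-value shape [PUB shape; a THEOREM on semistable pairs] and (2.4) [OPEN]
# (cell `b2b-bsdres`, sub-cell `multr1-p2`, gen 23)

HONEST FRAMING (cell `b2b-bsdres`, run/shared/lean/b2b/bsd-rank1-residual/, verbatim in every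
file): the goal of the cell is to DELETE the COMBINATION-SHAPED residual classes of the
Birch–Swinnerton-Dyer formula for ALL analytic-rank `≤ 1` elliptic curves over `ℚ` — "full BSD
formula for every rank `≤ 1` curve in class `C`" assembled STRICTLY from published theorems — so
that the rank-`≤ 1` remainder becomes exactly the CONSTRUCTION-SHAPED classes, which are TYPED
(missing-input `Prop`s), NOT attempted. This is not "finishing BSD". Sub-cell `multr1-p2` is a
RESEARCH ROUTE on class X11b (`ClassX11b W p := r_an = 1 ∧ p ≠ 2 ∧ mult(p) ∧ irr(p)`,
`Partition/Rows.lean`); no claim beyond the stated class and loci; X11b's label does not change;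
NOTHING is booked by this file.

ONE `Prop`-valued class-level SHAPE with a body (`P2.BDPValueOnTree`, PUB shape, nothing asserted,
NOT a named fact — consumed as a hypothesis) and theorems; no named fact; no `sorry`. The PUBLISHED
fact `Castella2018.thm32_exists_isBDPLFunction_valueAtOne` (Cas18 Thms. 3.1–3.2, square-free `N`)
enters as the hypothesis `h32`; every result using the OPEN shape `P2.IMCDivOnTree` (multr1-p1,
`RouteP2OpenInputFromPrint.lean`) is CONDITIONAL.

## What this file does

Route p2's ONE open input `P2OpenInputOnTreeAt W p` (gen 11) is the COMPOSITE (IMC≥)∘(BDP) at `𝟙`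
on the constructed `X_ac`. Route R1 (multr1-p1 gen 20, `RouteR1Halves.lean`) split ITS open input
into H1 (a BDP frame exists) + H2 (value at `𝟙`, PUB shape) + H3 (IMC equality, OPEN). This file does
the same for route p2 on ALL of its data, with the one-sided control (a tree theorem on every pair,
gens 13–17) in place of the control identity:

* §1 **`P2.BDPValueOnTree W p`** — (H1∧H2) on route p2's data, typed in the `∃∧`-currency of the
  fact `h32`: at every datum, anticyclotomic `(κ, γ)`, embedding datum `ι'`, infinite place `w₀`,
  point `P'` read as the Heegner point through `w₀` and embedding `e` inducing `𝔭_{ι'}`, THERE IS a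
  frame `(Ω_K ≠ 0, Ω_p, L)` with `IsBDPLFunction ι' 𝔭_{ι'} κ γ f_E Ω_K Ω_p L` whose value at `𝟙` is
  `u·((1 − a_p(E) p⁻¹)·log_{ω_E} P')²`, `u ∈ R₀ˣ` (multr1-p1's pointwise shape
  `R1.BDPValueAtOneOnTreeAt`). PUB SHAPE: Cas18 Thms. 3.1–3.2, printed for square-free `N`; at a
  split `p ≥ 5` the printed source [cas-split] = Castella, J. Inst. Math. Jussieu 17 (2018) Thm. 2.11
  works at ANY tame level prime to `p` under the classical Heegner hypothesis (its p. 2: "Fix a prime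
  `p ≥ 5`, an integer `N > 0` prime to `p`, and let `f ∈ S₂(Γ₀(Np))` be a newform … split
  multiplicative at `p`"), so a registry fact in that scope would discharge this shape on the
  769 432 ‖ 21 109 non-semistable SPLIT pairs too (census `census23/recount23b`); nothing of the kind
  is asserted here.
* §2 `P2.bdpValueOnTree_of_thm32_of_semistable` — on a SEMISTABLE pair `h32 ⟹ P2.BDPValueOnTree W p`
  (multr1-p1's `R1.exists_frame_bdpValueAtOneOnTreeAt_of_satisfiesHeegnerHypothesis`).
* §3 **`P2.openInputOnTreeAt_of_halves`** — on EVERY pair: `hnf` + `hGZK` + Kolyvagin + Poitou–Tate +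
  local Euler characteristic + (H1∧H2) `P2.BDPValueOnTree W p` + (2.4) `P2.IMCDivOnTree W p` ⟹
  `P2OpenInputOnTreeAt W p` (the proof of gen 23's `P2.openInputOnTreeAt_of_imcDiv_of_controlUpper`
  with the fact's instantiation replaced by the typed shape); `P2.missingLowerBoundAt_of_halves`.
* §4 RECORD **`P2.bsdp_of_onTree_halves`**: `∀ (E,p) ∈` X11b, `p ≥ 5 → BSD(E,p)` from published +
  cited facts and the typed inputs (2.4) `P2.IMCDivOnTree` ON EVERY PAIR [THE open input of the route,
  now literally the erratum's "(2.4) ⇐ [FW21, Thm. 4.41]" everywhere], (H1∧H2) `P2.BDPValueOnTree`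
  ONLY on the NON-semistable pairs (1 514 163 ‖ 40 334; PUB shape beyond the printed square-free
  scope), (REG)/(TC) per pair, the conjecture on 334 ‖ 35 peu-ramifié split-only pairs, the corner
  (64 ‖ 5). The composite `P2OpenInputOnTreeAt` no longer appears in the record.

CONDITIONAL on (2.4) (PREPRINT) and, off the semistable part, on (H1∧H2); deletes nothing; labels
UNCHANGED; X11b stays CONSTRUCTION-SHAPED.

References: [Castella2018] Thms. 2.3, 3.1, (3.2), 3.2, §5 (arXiv:1704.06608 pp. 5, 9, 12);
[Castella2018Erratum] (2.4), Thm. 1.1 (pp. 1, 4); [Castella2018Exceptional] Thm. 2.11 and p. 2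
(arXiv:1507.04260); [FouquetWan2021] Thm. 4.41; [CastellaHsieh2018] §3.3; [Miller2011LMS] Def. 1.1.
-/

noncomputable section

open scoped Classical NumberField

open WeierstrassCurve NumberField IsDedekindDomain Field PowerSeries
open Literature.NumberTheory.EllipticCurves Literature.NumberTheory.EllipticCurves.GreenbergSelmer
open Literature.NumberTheory.EllipticCurves.ModularForms
open Literature.NumberTheory.EllipticCurves.Rank1Residual
open Literature.NumberTheory.EllipticCurves.Rank1Residual.Typed
open Literature.NumberTheory.EllipticCurves.Wuthrich2014
open Literature.NumberTheory.EllipticCurves.Castella2018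
open Literature.NumberTheory.EllipticCurves.SteinWuthrich2013
open Literature.NumberTheory.EllipticCurves.Disegni2020
open Literature.NumberTheory.EllipticCurves.Skinner2016
open Literature.NumberTheory.EllipticCurves.BalakrishnanEtAl2019
open Literature.NumberTheory.QuadraticFields.Quadratic
open Literature.NumberTheory.GaloisRepresentations Literature.NumberTheory.GaloisCohomology
open Summit.BirchSwinnertonDyer.Rank1Residual.X11b.AcSelmer
open Summit.BirchSwinnertonDyer.Rank1Residual.X11b.Halves

namespace Summit.BirchSwinnertonDyer.Rank1Residual.X11b

/-! ### §1 (H1∧H2) on route p2's data — the BDP frame-and-value shape, typed -/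

section Shape

variable (W : WeierstrassCurve ℚ) [W.IsElliptic] [W.IsGloballyMinimal] (p : ℕ) [Fact p.Prime]

/-- **(H1∧H2) for route p2 — Castella 2018 Thms. 3.1–3.2 AS A SHAPE on route p2's data, typed.** At
every datum of `P2OpenInputOnTreeAt W p` (`(E,p)` in X11b, `p ≥ 5`, `ρ̄_{E,p}` onto; `K` imaginary
quadratic, `d_K` odd, `p ∤ d_K`, `p ∤ #𝓞_K^×`, every `ℓ ∣ N_E` split, `L(E^{d_K},1) ≠ 0`; a
parametrisation datum `Dt` of level `N_E` with `p ∤ c`; `P` its Heegner point read through `ι`,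
non-torsion; anticyclotomic `(κ, γ)`), for every embedding datum `ι' : ℚ̄_p ≃ ℂ` and infinite place
`w₀`, every `P' ∈ E(K)` read as the Heegner point `heegnerPointComplex Dt H` through `w₀`, and every
`e : K → ℚ_p` inducing the prime `𝔭_{ι'} = primeOfEmbeddingDatum p ι' w₀.embedding`: THERE ARE CM
periods `Ω_K ≠ 0`, `Ω_p ∈ R₀ˣ` and `L ∈ R₀⟦T⟧` with `IsBDPLFunction ι' 𝔭_{ι'} κ γ f_{Dt} Ω_K Ω_p L`
(Thm. 3.1) AND `L(𝟙) = u·((1 − a_p(E) p⁻¹)·log_{ω_E} P')²` for a unit `u` (Thm. 3.2 at `p ∣ N`,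
`ε_p = 0`; multr1-p1's pointwise shape `R1.BDPValueAtOneOnTreeAt W p e P' L (a_p(E))`). Exactly the
output of the PUBLISHED fact `thm32_exists_isBDPLFunction_valueAtOne` on these data when `N_E` is
square-free (`P2.bdpValueOnTree_of_thm32_of_semistable`); beyond that scope (non-semistable `E`) it
is a PUB-SHAPED typed input — for split `p ≥ 5` the printed source [cas-split] Thm. 2.11 is stated at
any tame level prime to `p` under the classical Heegner hypothesis, but no registry fact of that scope
exists and NOTHING is asserted here. A predicate on `(W, p)`; consumed as a hypothesis; NOT a named
fact. [cite: Castella2018, Thm. 3.1, display (3.2) and Thm. 3.2 (arXiv:1704.06608 p. 9) (shape only; nothing asserted)]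
[cite: Castella2018Exceptional, Thm. 2.11 and p. 2 (arXiv:1507.04260) (scope remark only; nothing asserted)] -/
def P2.BDPValueOnTree : Prop :=
  ∀ (N : ℕ) [NeZero N] (K : Type) [Field K] [NumberField K]
    (Dt : ModularParametrizationData W N) (H : HeegnerDatum N (NumberField.discr K)) (ι : K →+* ℂ)
    (P : (W.baseChange K).toAffine.Point),
    ClassX11b W p → 5 ≤ p → Surj W p → W.conductorNorm ℤ = N → IsImaginaryQuadratic K →
    Odd (NumberField.discr K) → ¬ (p : ℤ) ∣ NumberField.discr K → ¬ p ∣ Units.torsionOrder K →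
    SatisfiesHeegnerHypothesis N K →
    (W.quadraticTwist (NumberField.discr K : ℚ)).entireLFunction 1 ≠ 0 →
    WeierstrassCurve.Affine.Point.map ι.toRatAlgHom P = heegnerPointComplex Dt H →
    ¬ (p : ℤ) ∣ Dt.c → ¬ IsOfFinAddOrder P →
    ∀ (κ : ZpExtension K p), κ.IsAnticyclotomic →
      ∀ (γ : Field.absoluteGaloisGroup K) [Fact (κ.IsTopGenerator γ)]
        (ι' : PadicAlgCl p ≃+* ℂ) (w₀ : InfinitePlace K) (P' : (W.baseChange K).toAffine.Point),
        WeierstrassCurve.Affine.Point.map w₀.embedding.toRatAlgHom P' = heegnerPointComplex Dt H →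
        ∀ (e : K →+* ℚ_[p]),
          (∀ k : 𝓞 K, k ∈ (primeOfEmbeddingDatum p ι' w₀.embedding).asIdeal ↔ ‖e (k : K)‖ < 1) →
          ∃ (ΩK : ℂ) (Ωp : (unrIntegers p)ˣ) (L : UnrSeries p), ΩK ≠ 0 ∧
            IsBDPLFunction ι' (primeOfEmbeddingDatum p ι' w₀.embedding) κ γ Dt.f ΩK
              ((Ωp : unrIntegers p) : ℂ_[p]) L ∧
            R1.BDPValueAtOneOnTreeAt W p e P' L (W.LFunction p)

end Shape

/-! ### §2 The shape is a THEOREM on semistable pairs (Cas18 Thms. 3.1–3.2) -/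

section FromPrint

variable {W : WeierstrassCurve ℚ} [W.IsElliptic] [W.IsGloballyMinimal] {p : ℕ} [Fact p.Prime]

/-- **(H1∧H2) on a SEMISTABLE pair from the published fact** `h32` (Castella 2018 Thms. 3.1–3.2),
through multr1-p1's instantiation under the classical Heegner hypothesis
`R1.exists_frame_bdpValueAtOneOnTreeAt_of_satisfiesHeegnerHypothesis` (`p ∣ N_E` from mult, `Irr` from
X11b). [cite: Castella2018, Thm. 3.1, display (3.2) and Thm. 3.2 (arXiv:1704.06608 p. 9)] -/
theorem P2.bdpValueOnTree_of_thm32_of_semistable (h32 : thm32_exists_isBDPLFunction_valueAtOne)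
    (hss : Semistable W) : P2.BDPValueOnTree W p := by
  intro N _ K _ _ Dt H ιK P hX h5 _hs hN hK _hodd _hpd _hμ hHN _hLt _hP hc _hPinf κ hκ γ _ ι' w₀ P'
    hP' e he
  subst hN
  exact R1.exists_frame_bdpValueAtOneOnTreeAt_of_satisfiesHeegnerHypothesis h32 ι' Dt H h5 hss
    hX.2.2.2 (dvd_conductorNorm_of_mult hX.2.2.1) hK hHN hc w₀ hP' κ hκ γ Fact.out he

end FromPrint

/-! ### §3 Route p2's open input from its two halves, on EVERY pair -/

section Halves

variable {W : WeierstrassCurve ℚ} [W.IsElliptic] [W.IsGloballyMinimal] {p : ℕ} [Fact p.Prime]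

/-- **The composite open input from its halves, with the one-sided control** (any pair). Given `hnf`,
`hGZK`, the one-sided control `P2ControlUpperOnTreeAt W p` (which supplies only `HasCharValuationAt`:
`X_ac` torsion, `f_ac(0) ≠ 0`), one embedding datum `ι₀`, (H1∧H2) `P2.BDPValueOnTree W p` and (2.4)
`P2.IMCDivOnTree W p`: `P2OpenInputOnTreeAt W p`. Per datum: `𝔭 = 𝔭_{ι'}` for `ι' ∈ {ι₀, ι₀ ∘ conj}`
(`eq_primeOfEmbeddingDatum_or_eq_trans_starRingAut`); the datum's complex embedding is
`w₀.embedding ∘ τ` with `τ ∈ Gal(K/ℚ)`, so `τ_* P` is the Heegner point read through `w₀`; THE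
embedding `embAt K p 𝔭` induces `𝔭`; (H1∧H2) gives a frame and its value at `𝟙` for `τ_* P`, (2.4) the
divisibility at that frame, team x11b3's `Halves.imcLowerWaldspurgerOnTreeAt_of_value_of_dvd` the
inequality, and `ord_p log(τ_* P) = ord_p log P` (`rank_ℤ E(K) = 1`, `τ² = 1`). CONDITIONAL on both
halves. [cite: Castella2018, Thms. 2.3, 3.1, 3.2 and §5 (arXiv:1704.06608 pp. 5, 9, 12)]
[cite: Castella2018Erratum, (2.4) and Thm. 1.1 (pp. 1, 4)] -/
theorem P2.openInputOnTreeAt_of_halves_of_controlUpper (hnf : exists_isNewformOf)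
    (hGZK : rank_eq_analyticRank_of_analyticRank_le_one) (hC : P2ControlUpperOnTreeAt W p)
    (ι₀ : PadicAlgCl p ≃+* ℂ) (h2 : P2.BDPValueOnTree W p) (h3 : P2.IMCDivOnTree W p) :
    P2OpenInputOnTreeAt W p := by
  intro N _ K _ _ Dt H ιK P hX h5 hs hN hK hodd hpd hμ hHN hLt hP hc hPinf κ hκ γ _ 𝔭 h𝔭 he hf
  obtain ⟨n, hn, -⟩ := hC N K Dt H ιK P hX h5 hs hN hK hodd hpd hμ hHN hLt hP hc hPinf κ hκ γ 𝔭 h𝔭 he hf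
  have h3' := h3 N K Dt H ιK P hX h5 hs hN hK hodd hpd hμ hHN hLt hP hc hPinf κ hκ γ
  have h2' := h2 N K Dt H ιK P hX h5 hs hN hK hodd hpd hμ hHN hLt hP hc hPinf κ hκ γ
  subst hN
  obtain ⟨hr, -, -, -⟩ := hX
  obtain ⟨w₀⟩ := (inferInstance : Nonempty (InfinitePlace K))
  have hp2 : p ≠ 2 := by omega
  -- `rank_ℤ E(K) = 1` (Gross–Zagier–Kolyvagin)
  have hrk : (W.baseChange K).mordellWeilRank = 1 :=
    mordellWeilRank_baseChange_eq_one_of_twist_ne_zero W hGZK hnf hr hK.1 hLt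
  -- the datum's complex embedding is `w₀.embedding ∘ τ` for some `τ ∈ Gal(K/ℚ)`, `τ² = 1`
  haveI : IsGalois ℚ K := by
    haveI : Algebra.IsQuadraticExtension ℚ K := ⟨hK.1⟩
    infer_instance
  obtain ⟨σ, hσ⟩ := ComplexEmbedding.exists_comp_symm_eq_of_comp_eq (k := ℚ) w₀.embedding ιK
    (by ext x; simp)
  set τ : K →+* K := ((σ.symm : K ≃ₐ[ℚ] K) : K →+* K) with hτdef
  have hτ : ∀ x, τ (τ x) = x := by
    intro x
    have hcard : Nat.card (K ≃ₐ[ℚ] K) = 2 := by rw [IsGalois.card_aut_eq_finrank, hK.1]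
    have hsq : σ.symm * σ.symm = 1 := by
      have h := pow_card_eq_one' (G := K ≃ₐ[ℚ] K) (x := σ.symm)
      rwa [hcard, pow_two] at h
    have := congrArg (fun g : K ≃ₐ[ℚ] K ↦ g x) hsq
    simpa [hτdef, AlgEquiv.mul_apply] using this
  -- the Galois conjugate `P' = τ_* P` is the Heegner point read through `w₀.embedding`
  set P' := WeierstrassCurve.Affine.Point.map τ.toRatAlgHom P with hP'def
  have hP' : WeierstrassCurve.Affine.Point.map w₀.embedding.toRatAlgHom P' =
      heegnerPointComplex Dt H := by
    rw [hP'def, WeierstrassCurve.Affine.Point.map_map]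
    have hcomp : w₀.embedding.toRatAlgHom.comp τ.toRatAlgHom = ιK.toRatAlgHom := by
      apply AlgHom.ext
      intro x
      have := RingHom.congr_fun hσ x
      simpa [hτdef] using this
    rw [hcomp]
    exact hP
  have hlog : ∀ e : K →+* ℚ_[p], padicLogOrd W p e P' = padicLogOrd W p e P := fun e ↦
    R1.padicLogOrd_map_eq_of_rank_one W p e P hp2 τ hτ hrk hPinf
  -- THE embedding at `𝔭` induces `𝔭`
  have hemb : ∀ k : 𝓞 K, k ∈ 𝔭.asIdeal ↔ ‖embAt K p 𝔭 h𝔭 he hf (k : K)‖ < 1 :=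
    mem_asIdeal_iff_norm_embAt_lt_one 𝔭 h𝔭 he hf
  -- every degree-one prime above `p` is induced by `ι₀` or by `ι₀ ∘ conj`
  have key : ∀ ι' : PadicAlgCl p ≃+* ℂ, 𝔭 = primeOfEmbeddingDatum p ι' w₀.embedding →
      IMCLowerWaldspurgerOnTreeAt p κ 𝔭 γ (embAt K p 𝔭 h𝔭 he hf) P := by
    intro ι' h𝔭eq
    subst h𝔭eq
    obtain ⟨ΩK, Ωp, L, -, hL, u, hu⟩ := h2' ι' w₀ P' hP' (embAt K p _ h𝔭 he hf) hemb
    refine imcLowerWaldspurgerOnTreeAt_of_padicLogOrd_eq W p _ (hlog _) ?_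
    exact imcLowerWaldspurgerOnTreeAt_of_value_of_dvd hn
      (h3' Dt.f Dt.isNewformOf ι' w₀ ΩK Ωp L hL) u (W.LFunction p) hu
  rcases eq_primeOfEmbeddingDatum_or_eq_trans_starRingAut p ι₀ hK w₀ h𝔭 with h | h
  · exact key ι₀ h
  · exact key _ h

/-- **ROUTE p2's OPEN INPUT FROM ITS TWO HALVES, ON EVERY PAIR.** For every globally minimal elliptic
`W/ℚ` and prime `p`: `P2OpenInputOnTreeAt W p` follows from the PUBLISHED `hnf` (modularity), `hGZK`,
`hKo` (Kolyvagin), the CITED `hPT` (Poitou–Tate) and `hEP` (local Euler characteristic) — through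
`p2ControlUpperOnTreeAt_of_facts` — and the two typed halves: (H1∧H2) `P2.BDPValueOnTree W p` [PUB
shape; a theorem on semistable pairs, §2] and (2.4) `P2.IMCDivOnTree W p` [OPEN]. CONDITIONAL on both.
[cite: Castella2018, Thms. 2.3, 3.1, 3.2, §5 (arXiv:1704.06608 pp. 5, 9, 12)] [cite: Castella2018Erratum, (2.4) (p. 4)]
[cite: MilneADT2006, Ch. I, Thm. 4.10(b) and Thm. 2.8] -/
theorem P2.openInputOnTreeAt_of_halves (hnf : exists_isNewformOf)
    (hGZK : rank_eq_analyticRank_of_analyticRank_le_one)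
    (hKo : ∀ (N : ℕ) [NeZero N] (W : WeierstrassCurve ℚ) (K : Type) [Field K] [NumberField K],
      kolyvagin N W K)
    (hPT : ∀ (K : Type) [Field K] [NumberField K], poitouTate_sum_localTatePairing_eq_zero K)
    (hEP : ∀ (K : Type) [Field K] [NumberField K] (v : HeightOneSpectrum (𝓞 K)),
      localEulerPoincareCharacteristic (v.adicCompletion K))
    (h2 : P2.BDPValueOnTree W p) (h3 : P2.IMCDivOnTree W p) : P2OpenInputOnTreeAt W p := by
  obtain ⟨ι₀⟩ := PadicAlgCl.nonempty_ringEquiv_complex p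
  exact P2.openInputOnTreeAt_of_halves_of_controlUpper hnf hGZK
    (p2ControlUpperOnTreeAt_of_facts W p hKo hPT hEP) ι₀ h2 h3

/-- **The main-conjecture half `ord_p #Ш(E)_an ≤ ord_p #Ш(E)` on ANY X11b ∧ surj pair at `p ≥ 5`
from published + cited facts and the two halves AT THE PAIR.** Gen 18's
`P2.missingLowerBoundAt_of_openInputAt` with the composite open input assembled by
`P2.openInputOnTreeAt_of_halves`. CONDITIONAL on both halves; nothing booked.
[cite: Castella2018Erratum, (2.4) (p. 4)] [cite: Castella2018, Thms. 2.3, 3.2]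
[cite: JetchevSkinnerWan2017, §7.4.1 (pp. 30–31)] [cite: Wuthrich2014, Prop. 21 (p. 400)] [cite: Miller2011LMS, Def. 1.1] -/
theorem P2.missingLowerBoundAt_of_halves
    (hGZ : ∀ (N : ℕ) [NeZero N] (W : WeierstrassCurve ℚ) (K : Type) [Field K] [NumberField K],
      gross_zagier N W K)
    (hKo : ∀ (N : ℕ) [NeZero N] (W : WeierstrassCurve ℚ) (K : Type) [Field K] [NumberField K],
      kolyvagin N W K)
    (hWu : sha_dvd_analyticSha) (hGZK : rank_eq_analyticRank_of_analyticRank_le_one)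
    (hnf : exists_isNewformOf) (hHL : HoffsteinLuo1997_exists_twist_L_one_ne_zero)
    (hMaz : mazur_not_dvd_maninConstant_of_odd)
    (hPT : ∀ (K : Type) [Field K] [NumberField K], poitouTate_sum_localTatePairing_eq_zero K)
    (hEP : ∀ (K : Type) [Field K] [NumberField K] (v : HeightOneSpectrum (𝓞 K)),
      localEulerPoincareCharacteristic (v.adicCompletion K))
    -- the two halves, at the pair
    (h2 : P2.BDPValueOnTree W p) (h3 : P2.IMCDivOnTree W p)
    (hX : ClassX11b W p) (hp5 : 5 ≤ p) (hsurj : Surj W p) : Typed.MissingLowerBoundAt W p :=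
  P2.missingLowerBoundAt_of_openInputAt W p hGZ hKo hWu hGZK
    (hasEntireLFunction_rat_of_exists_isNewformOf hnf) hnf hHL hMaz hPT hEP
    (P2.openInputOnTreeAt_of_halves hnf hGZK hKo hPT hEP h2 h3) hX hp5 hsurj

end Halves

/-! ### §4 The class-level record over the halves -/

/-- **Route p2 — STATEMENT OF RECORD OVER THE HALVES (gen 23).** `∀ (E, p) ∈` X11b,
`p ≥ 5 → BSD(E, p)` from route p2's and the lever's published named facts (+ Kolyvagin 1990
Thm. A, Castella 2018 Thms. 3.1–3.2), the cited Poitou–Tate / local Euler characteristic, and the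
typed inputs: **(2.4) `P2.IMCDivOnTree` ON EVERY PAIR — THE open input of the route, the one-sided
anticyclotomic main conjecture divisibility for Castella's `L_p(f)` [⇐ FW21 Thm. 4.41, PREPRINT]**;
(H1∧H2) `P2.BDPValueOnTree` ONLY on the NON-semistable pairs (1 514 163 ‖ 40 334 of 2 267 348 ‖
70 420; PUB shape — Cas18 Thms. 3.1–3.2 beyond their printed square-free scope; on the 753 185 ‖
30 086 semistable pairs it is the theorem §2); (REG) per pair; (TC) one twist certificate per
split-only pair with `p ∤ ∏c` (54 755 ‖ 3 291); (T2∗′) the conjecture `RelativeExceptionalLeadingTermAt`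
only on split-only pairs with `p ∣ ∏c` (334 ‖ 35); (T4′) the corner (64 ‖ 5). Gen 22's
`P2.bsdp_of_onTree_cyclotomic_twistCertificate` with the composite (T1) `P2OpenInputOnTreeAt`
REPLACED by its halves through `P2.openInputOnTreeAt_of_halves`. CONDITIONAL; nothing booked; labels
UNCHANGED; X11b stays CONSTRUCTION-SHAPED.
[cite: Castella2018Erratum, (2.4) (p. 4)] [cite: Castella2018, Thms. 2.3, 3.1, 3.2]
[cite: McCallumLMS1991, §1 Theorem (Kolyvagin), p. 296] [cite: Disegni2020, Thm. 1 (§1.2), Thm. 4, (∗)]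
[cite: Wuthrich2014, Thm. 3 (p. 383), Prop. 21 (p. 400)] [cite: SteinWuthrich2013, Thm. 6.1, §4.2]
[cite: Miller2011LMS, Def. 1.1] -/
theorem P2.bsdp_of_onTree_halves
    -- route p2's published inputs
    (hGZ : ∀ (N : ℕ) [NeZero N] (W : WeierstrassCurve ℚ) (K : Type) [Field K] [NumberField K],
      gross_zagier N W K)
    (hKo : ∀ (N : ℕ) [NeZero N] (W : WeierstrassCurve ℚ) (K : Type) [Field K] [NumberField K],
      kolyvagin N W K)
    (hB : ∀ (N : ℕ) [NeZero N] (W : WeierstrassCurve ℚ) (K : Type) [Field K] [NumberField K],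
      Kolyvagin1990_padicValNat_card_sha_le N W K)
    (hWu : sha_dvd_analyticSha) (hGZK : rank_eq_analyticRank_of_analyticRank_le_one)
    (hnf : exists_isNewformOf) (hHL : HoffsteinLuo1997_exists_twist_L_one_ne_zero)
    (hMaz : mazur_not_dvd_maninConstant_of_odd) (hBDMTV : thm12_not_le_normalizer_splitCartan)
    (h32 : thm32_exists_isBDPLFunction_valueAtOne)
    (hPT : ∀ (K : Type) [Field K] [NumberField K], poitouTate_sum_localTatePairing_eq_zero K)
    (hEP : ∀ (K : Type) [Field K] [NumberField K] (v : HeightOneSpectrum (𝓞 K)),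
      localEulerPoincareCharacteristic (v.adicCompletion K))
    -- the lever's published inputs
    (hK : kato_charIdeal_dvd_multiplicative_of_surjective)
    (hJn : thm61_nonsplitMultiplicative) (hJs : thm61_splitMultiplicative)
    (hHn : exists_isMultCanonical) (hHs : exists_isSplitMultCanonical)
    (hD : thm1_padicBSD_rankOne_multiplicative) (hpar : nonempty_modularParametrizationData)
    -- (2.4) THE open input, on every pair
    (hDiv : ∀ (W : WeierstrassCurve ℚ) [W.IsElliptic] [W.IsGloballyMinimal] (p : ℕ) [Fact p.Prime],
      ClassX11b W p → 5 ≤ p → P2.IMCDivOnTree W p)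
    -- (H1∧H2) the BDP frame-and-value shape, on the NON-semistable pairs only
    (hVal : ∀ (W : WeierstrassCurve ℚ) [W.IsElliptic] [W.IsGloballyMinimal] (p : ℕ) [Fact p.Prime],
      ClassX11b W p → 5 ≤ p → ¬ Semistable W → P2.BDPValueOnTree W p)
    -- (REG)
    (hReg : ∀ (W : WeierstrassCurve ℚ) [W.IsElliptic] [W.IsGloballyMinimal] (p : ℕ) [Fact p.Prime],
      ClassX11b W p → 5 ≤ p → ClassClosure.RegulatorNonvanishingAt W p)
    -- (TC) ONE twist certificate per split-only pair with `p ∤ ∏c`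
    (hTC : ∀ (W : WeierstrassCurve ℚ) [W.IsElliptic] [W.IsGloballyMinimal] (p : ℕ) [Fact p.Prime],
      ClassX11b W p → 5 ≤ p → W.HasSplitMultiplicativeReductionAtPrime p →
      (¬ ∃ (m : ℕ) (_ : Fact m.Prime), m ≠ p ∧ W.HasMultiplicativeReductionAtPrime m) →
      ¬ p ∣ W.tamagawaProduct →
      ∃ (K : Type) (_ : Field K) (_ : NumberField K) (Wd : WeierstrassCurve ℚ) (_ : Wd.IsElliptic)
        (_ : Wd.IsGloballyMinimal) (Cd : VariableChange ℚ) (qd : ℚ),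
        IsImaginaryQuadratic K ∧ SatisfiesHeegnerHypothesis (W.conductorNorm ℤ) K ∧
        NumberField.discr K < -4 ∧ Cd • W.quadraticTwist (NumberField.discr K : ℚ) = Wd ∧
        Wd.entireLFunction 1 / (Wd.realPeriodRat : ℂ) = (qd : ℂ) ∧ qd ≠ 0 ∧ padicValRat p qd = 0)
    -- (T2∗′) the exceptional conjecture, only on split-only pairs with `p ∣ ∏c`
    (hC : ∀ (W : WeierstrassCurve ℚ) [W.IsElliptic] [W.IsGloballyMinimal] (p : ℕ) [Fact p.Prime],
      ClassX11b W p → 5 ≤ p → W.HasSplitMultiplicativeReductionAtPrime p →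
      (¬ ∃ (m : ℕ) (_ : Fact m.Prime), m ≠ p ∧ W.HasMultiplicativeReductionAtPrime m) →
      p ∣ W.tamagawaProduct → ClassClosure.RelativeExceptionalLeadingTermAt W p)
    -- (T4′)
    (hCorner : ∀ (W : WeierstrassCurve ℚ) [W.IsElliptic] [W.IsGloballyMinimal] (p : ℕ)
      [Fact p.Prime], ClassX11b W p → ¬ Surj W p → (p = 5 ∨ p = 7) →
        p ∣ padicValInt p W.minimalDiscriminantInt → ¬ Ram W p → Typed.MissingPPartAt W p)
    (W : WeierstrassCurve ℚ) [W.IsElliptic] [W.IsGloballyMinimal] (p : ℕ) [Fact p.Prime]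
    (hX : ClassX11b W p) (hp5 : 5 ≤ p) : BSDp W p :=
  P2.bsdp_of_onTree_cyclotomic_twistCertificate hGZ hKo hB hWu hGZK
    (hasEntireLFunction_rat_of_exists_isNewformOf hnf) hnf hHL hMaz hBDMTV hPT hEP hK hJn hJs hHn hHs
    hD hpar
    (fun W _ _ p _ N _ K _ _ Dt H ι P hX hp5 ↦ by
      have h2 : P2.BDPValueOnTree W p := by
        by_cases hss : Semistable W
        · exact P2.bdpValueOnTree_of_thm32_of_semistable h32 hss
        · exact hVal W p hX hp5 hss
      exact P2.openInputOnTreeAt_of_halves hnf hGZK hKo hPT hEP h2 (hDiv W p hX hp5) N K Dt H ι P hX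
        hp5)
    hReg hTC hC hCorner W p hX hp5

end Summit.BirchSwinnertonDyer.Rank1Residual.X11b

end
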